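import Mathlib.Data.Nat.Choose.Basic
import Mathlib.Data.Nat.Factorial.Basic
import Mathlib.Data.Nat.Prime.Int
import Mathlib.LinearAlgebra.FiniteDimensional.Basic
import Mathlib.LinearAlgebra.FiniteDimensional.Lemmas
import Mathlib.LinearAlgebra.Dimension.Constructions
import Mathlib.LinearAlgebra.Dimension.Finite
import Mathlib.Tactic.LinearCombination
import Mathlib.Tactic.FieldSimp
import Mathlib.Tactic.Ring
import Mathlib.Tactic.NormNum
import Mathlib.Tactic.Linarith
import HarnessLib

/-!
# NSC(−2) seed census III (report `NSC-SEEDS-3.md`, prover 1 gen 59): the HN-tower door — the necessity example, the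
# object-level 27/33/42-test, the Ext budget and the Weil lattice at `P₀`; def-free cores

Family `hodge`, b2b cell `hweil` (helper of item stmt-HodgeConjecture-2524; cell target NSC(−2) =
`Ring2.Hypotheses.WeilClassesComponent 3 3 [−2]`). Report `run/shared/lean/b2b/hodge-weil/b2b-hweil-pv1-g59/NSC-SEEDS-3.md`
(orders LADDER `## CARVER v135` C819 (d)); an `Nsc` file (C807 (d)) with NO `Ring2*` import (nothing of ring-2 is used). Only what is stated below is formalised; the geometric statements are the report's (seat
level). `P₀ = E⁶`, `E = ℂ/ℤ[ζ₃]`, `K = ℚ(√−3)`, `h` of weights `(2,1,1,1,1,1)`, `W` the Weil plane, `w(c) := c·ω_α − c̄·ω_ᾱ` (`c ∈ K`) the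
rational Weil classes.

* `nsc3_necessity_example` — report §1.2: on `S = E₂ × E₄ ⊂ P₀` (classes `e₂, e₄, Δ = Δ₂₄`, Gram matrix `[[0,1,1],[1,0,1],[1,1,0]]`) the
  classes `a = Δ + e₂ − e₄`, `b = e₄ − e₂` have `(a − b)² = −8` (index 1 both ways: `Ext¹(L_b, L_a) = Ext¹(L_a, L_b) = k⁴`), slopes
  `a·h_S = 2 > b·h_S = 0`, `c₁ = a + b = Δ`, and `{h_S, Δ, a}` has Gram determinant `8 ≠ 0` — the numerics behind the NECESSITY EXAMPLE: the
  non-split extension `0 → L_a → G → L_b → 0`, pulled back to `P₀`, LIFTS along the polarised Weil direction `ξ₂₄` while both of its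
  Harder–Narasimhan factors are obstructed (`ξ₂₄·(e₂ − e₄) ≠ 0`): the hypothesis «no upward Ext¹» of THEOREM DÉVISSAGE cannot be dropped.
  (Why an EQUAL-weight block: in the block `{1,4}` (weights `2,1`) a polarised Weil direction kills the graph class `[Γ_λ]` iff `N(λ) = 2`,
  impossible by the tree's `Literature.NumberTheory.NumberFields.K3.norm_int_ne_two` / ring-2's `norm_ne_two` — not restated here.)
* `nsc3_test_of_rank_eq` — report §2, the abstract form of the 27-TEST: if `rank(σ ∘ ob) = dim W` then `ob` is onto `W` and `σ` is
  injective on `W` (applied with `ob : H¹(T_X) → Ext²(G,G)`, `σ` the semiregularity map: `ext²(G,G) = rank(ξ ↦ ξ ⌟ ch G)` forces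
  BF-semiregularity).
* `nsc3_obstruction_counts` — the dimension bookkeeping of LEMMA OB^{obj}: `36 − 9 = 27`, trace part `15`, traceless `≥ 18` (Gaussian) resp.
  `≥ 27`, hence `ext² ≥ 33` resp. `≥ 42`; target of `σ` has dimension `Σ_q C(6,q)·C(6,q+2) = 495`.
* `nsc3_euler_form_gaussian` — report §3: `Σ_{k=0}^{6} (−1)^k/(k!(6−k)!) = 0`: the Gaussian part `r·e^{th}` contributes nothing to
  `χ(G,G) = ∫ ch(G^∨)·ch(G)`, so `χ(G,G) = −∫w²` for a Gaussian–Weil object.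
* `nsc3_three_dvd_norm_iff` — report §3 (lattice): `3 ∣ a² − ab + b² ↔ 3 ∣ a + b`, i.e. `N(μ) ≡ 0 (3) ↔ (1 − ζ) ∣ μ`: the self-pairing
  `χ(y,y) = 2N(c) ∈ ℤ` upgrades `c ∈ 𝔡⁻¹ = (1/√−3)𝒪_K` to `c ∈ 𝒪_K`; with `nsc3_budget` (`2N(c) ≥ 2` on `𝒪_K ∖ 0`, parity and the relation
  among `ext¹, ext², ext³` for a simple object).
* `nsc3_lagrange_two`, `nsc3_rank_two_window_parity` — report §4: the Bogomolov deficits of a two-factor HN tower with Gaussian total sum to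
  `r₁r₂(t₁ − t₂)²/(2(r₁+r₂))`, and in the rank-2 window `n₁ ≡ n₂ (mod 2)`.

HONEST FRAMING: census / obstruction bookkeeping for the anchor objects of ONE cell; nothing here is a rung; no case of the Hodge conjecture
is proved or claimed; no statement of [Markman 2025] / [Perry 2026] is used. [cite: BuchweitzFlenner2003, Prop. 4.2, Cor. 4.3, Prop. 4.4]
[cite: vanGeemen1994HodgeAV, Thm. 6.12]
-/

-- mandated namespace `Summit.HodgeConjecture.HodgeConjecture.…` (Problem = Summit) trips `linter.dupNamespace`; the lakefile disables it
-- tree-wide (weak option), restated here so stand-alone elaboration is warning-free too.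
set_option linter.dupNamespace false

namespace Summit.HodgeConjecture.HodgeConjecture.WeilTypeLadder

section NscSeedsThree

/-- **NSC-SEEDS-3 §1.2 (NECESSITY EXAMPLE, numerics).**  In the basis `(e₂, e₄, Δ)` of `NS(E₂ × E₄)` with Gram matrix
`[[0,1,1],[1,0,1],[1,1,0]]` (so `v·w = v₁w₂ + v₂w₁ + v₁w₃ + v₃w₁ + v₂w₃ + v₃w₂`), take `a = (1,−1,1)`, `b = (−1,1,0)`, `h_S = (1,1,0)`.
Then: `(a−b)² = −8` (with `a − b = (2,−2,1)`), `a² = b² = −2`, `a·b = 2`, `(a+b) = (0,0,1) = Δ` with `Δ² = 0`, slopes `a·h_S = 2`,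
`b·h_S = 0`, and the Gram determinant of `(h_S, Δ, a)` — matrix `[[2,2,2],[2,0,0],[2,0,−2]]` — is `8`.  Consequences in the report:
`L_{a−b}` has index `1` with `h¹ = −(a−b)²/2 = 4` in BOTH directions, the extension `G` of `L_b` by `L_a` is simple with HN filtration
`L_a ⊂ G`, and a first-order direction with `ξ·h_S = ξ·Δ = 0 ≠ ξ·a` exists (at `P₀`: the Weil direction `ξ₂₄`; the weighted block `{1,4}`
is excluded because `N(λ) = 2` is impossible, `Literature.NumberTheory.NumberFields.K3.norm_int_ne_two`).
[machine: `code/pv1-g59/nsc3.py example`] [folklore: intersection theory on E × E] -/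
theorem nsc3_necessity_example :
    -- (a-b)² for a-b = (2,-2,1):  2·(v₁v₂ + v₁v₃ + v₂v₃)
    (2 * ((2 : ℤ) * (-2) + 2 * 1 + (-2) * 1) = -8) ∧
    -- a² for a = (1,-1,1), b² for b = (-1,1,0), a·b
    (2 * ((1 : ℤ) * (-1) + 1 * 1 + (-1) * 1) = -2) ∧ (2 * ((-1 : ℤ) * 1 + (-1) * 0 + 1 * 0) = -2) ∧
    ((1 : ℤ) * 1 + (-1) * (-1) + 1 * 0 + 1 * (-1) + (-1) * 0 + 1 * 1 = 2) ∧
    -- slopes a·h_S, b·h_S with h_S = (1,1,0)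
    ((1 : ℤ) * 1 + (-1) * 1 + 1 * 0 + 1 * 1 + (-1) * 0 + 1 * 1 = 2) ∧ ((-1 : ℤ) * 1 + 1 * 1 + (-1) * 0 + 0 * 1 + 1 * 0 + 0 * 1 = 0) ∧
    -- h¹(L_{a-b}) = -(a-b)²/2 = 4 and the Gram determinant of (h_S, Δ, a)
    (-(-8 : ℤ) / 2 = 4) ∧ ((2 : ℤ) * (0 * (-2) - 0 * 0) - 2 * (2 * (-2) - 0 * 2) + 2 * (2 * 0 - 0 * 2) = 8) := by
  norm_num

/-- **NSC-SEEDS-3 §2 (the abstract 27-TEST).**  Let `ob : V → W` and `σ : W → U` be linear maps of finite-dimensional spaces with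
`dim range(σ ∘ ob) = dim W`.  Then `ob` is surjective and `σ` is injective.  In the report `V = H¹(T_X)`, `W = Ext²(G,G)`,
`σ` = the semiregularity map, `ob(ξ) = ⟨ξ, −At(G)⟩` the obstruction, and `σ ∘ ob = (ξ ↦ ⟨ξ, ch(G)⟩)` (Buchweitz–Flenner): an object
whose `ext²` EQUALS the rank of the contraction map is semiregular, with `Ext²` spanned by obstruction classes.
[cite: BuchweitzFlenner2003, Prop. 4.2 and Prop. 4.4] -/
theorem nsc3_test_of_rank_eq {F V W U : Type*} [Field F] [AddCommGroup V] [Module F V] [AddCommGroup W] [Module F W]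
    [AddCommGroup U] [Module F U] [FiniteDimensional F V] [FiniteDimensional F W]
    (ob : V →ₗ[F] W) (σ : W →ₗ[F] U)
    (h : Module.finrank F (LinearMap.range (σ ∘ₗ ob)) = Module.finrank F W) :
    Function.Surjective ob ∧ Function.Injective σ := by
  have hcomp : LinearMap.range (σ ∘ₗ ob) = (LinearMap.range ob).map σ := LinearMap.range_comp ob σ
  have h1 : Module.finrank F (LinearMap.range (σ ∘ₗ ob)) ≤ Module.finrank F (LinearMap.range ob) := by
    rw [hcomp]; exact Submodule.finrank_map_le σ (LinearMap.range ob)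
  have h2 : Module.finrank F (LinearMap.range ob) ≤ Module.finrank F W := Submodule.finrank_le _
  have htop : LinearMap.range ob = ⊤ := Submodule.eq_top_of_finrank_eq (le_antisymm h2 (h ▸ h1))
  refine ⟨LinearMap.range_eq_top.mp htop, ?_⟩
  -- σ injective: range σ ⊇ range (σ ∘ ob) has full dimension, so ker σ = ⊥ by rank–nullity
  have h3 : Module.finrank F (LinearMap.range (σ ∘ₗ ob)) ≤ Module.finrank F (LinearMap.range σ) :=
    Submodule.finrank_mono (LinearMap.range_comp_le_range ob σ)
  have h4 := LinearMap.finrank_range_add_finrank_ker σ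
  have h5 : Module.finrank F (LinearMap.range σ) ≤ Module.finrank F W := by
    have := Submodule.finrank_le (LinearMap.ker σ); omega
  have hker : Module.finrank F (LinearMap.ker σ) = 0 := by omega
  have hbot : LinearMap.ker σ = ⊥ := Submodule.finrank_eq_zero.mp hker
  exact LinearMap.ker_eq_bot.mp hbot

/-- **NSC-SEEDS-3 §2 (LEMMA OB^{obj}, dimension bookkeeping).**  On a Weil-type abelian sixfold: `dim H¹(T_X) = 6·6 = 36`; the `h`-symmetric
directions (`ξ ⌟ h = 0`) form `6·7/2 = 21` dimensions, so `ξ ↦ ξ ⌟ h` has rank `36 − 21 = 15 = h^{0,2}`; `ξ ⌟ ω_α = 0 ⟺ C_LL = 0` and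
`ξ ⌟ ω_ᾱ = 0 ⟺ C_RR = 0` are `9 + 9 = 18` independent conditions (`6 + 6 = 12` of them inside the `h`-symmetric ones), so the joint kernel is
the `21 − 12 = 9`-dimensional polarised Weil tangent space and `rank(ξ ↦ ξ ⌟ ch G) = 36 − 9 = 27`; for rank `r ≠ 0` the trace part `H²(𝒪)·id`
(`15`) and the traceless part (`≥ 18` if the polynomial part of `ch` is Gaussian, `≥ 27` if not) give `ext²(G,G) ≥ 33` resp. `≥ 42`; the
semiregularity map lands in `⊕_{q=0}^{4} H^{q+2}(Ω^q)` of dimension `Σ C(6,q)C(6,q+2) = 495`.  [machine, exact, all 36 directions at `P₀`: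
`code/pv1-g59/nsc3.py obrank`] -/
theorem nsc3_obstruction_counts :
    (6 * 6 = 36 ∧ 6 * 7 / 2 = 21 ∧ 36 - 21 = 15 ∧ 9 + 9 = 18 ∧ 21 - (6 + 6) = 9 ∧ 36 - 9 = 27) ∧
    (15 + 18 = 33 ∧ 15 + 27 = 42) ∧
    (Nat.choose 6 0 * Nat.choose 6 2 + Nat.choose 6 1 * Nat.choose 6 3 + Nat.choose 6 2 * Nat.choose 6 4 +
      Nat.choose 6 3 * Nat.choose 6 5 + Nat.choose 6 4 * Nat.choose 6 6 = 495) := by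
  decide

/-- **NSC-SEEDS-3 §3 (the Gaussian part is Euler-orthogonal to itself).**  `Σ_{k=0}^{6} (−1)^k/(k!·(6−k)!) = (1 − 1)⁶/6! = 0`: for
`ch(G) = r·e^{th} + w` on an abelian sixfold (`td = 1`, `h³·W = 0`), `χ(G,G) = ∫ ch(G^∨)·ch(G) = r²t⁶(∫h⁶)·Σ_k (−1)^k/(k!(6−k)!) − ∫w² = −∫w²`,
and `−∫w² > 0` by Hodge–Riemann (`W` is `h`-primitive of type `(3,3)`; at `P₀`: `∫w(c)² = −2N(c)`). -/
theorem nsc3_euler_form_gaussian :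
    (1 : ℚ) / (Nat.factorial 0 * Nat.factorial 6) - 1 / (Nat.factorial 1 * Nat.factorial 5) + 1 / (Nat.factorial 2 * Nat.factorial 4)
      - 1 / (Nat.factorial 3 * Nat.factorial 3) + 1 / (Nat.factorial 4 * Nat.factorial 2) - 1 / (Nat.factorial 5 * Nat.factorial 1)
      + 1 / (Nat.factorial 6 * Nat.factorial 0) = 0 := by
  norm_num [Nat.factorial]

/-- **NSC-SEEDS-3 §3 (Weil lattice at `P₀`: from the inverse different to `𝒪_K`).**  For `μ = a + bζ₃ ∈ 𝒪_K`, `N(μ) = a² − ab + b²` and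
`3 ∣ N(μ) ↔ 3 ∣ a + b ↔ (1 − ζ₃) ∣ μ`.  In the report: pairing integrality (`χ(y ⊗ L_u) ∈ ℤ`, `χ(y, 𝒪_{Γ_F}) ∈ ℤ`) puts the Weil coordinate `c`
of a pure-Weil K-class `y` in the inverse different `(1/√−3)𝒪_K`, i.e. `c = μ/√−3`, `N(c) = N(μ)/3`; the SELF-pairing `χ(y,y) = 2N(c) ∈ ℤ`
then forces `3 ∣ N(μ)`, hence `√−3 ∣ μ` and `c ∈ 𝒪_K`: `6𝒪_K ⊂ W_K ⊂ 𝒪_K`. [machine: `nsc3.py lattice`] -/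
theorem nsc3_three_dvd_norm_iff (a b : ℤ) : (3 ∣ a ^ 2 - a * b + b ^ 2) ↔ (3 ∣ a + b) := by
  constructor
  · intro h
    have h3 : (3 : ℤ) ∣ (a + b) ^ 2 := by
      have : (a + b) ^ 2 = (a ^ 2 - a * b + b ^ 2) + 3 * (a * b) := by ring
      rw [this]; exact dvd_add h (dvd_mul_right 3 _)
    exact Int.prime_three.dvd_of_dvd_pow h3
  · rintro ⟨k, hk⟩
    refine ⟨3 * k ^ 2 - a * b, ?_⟩
    have : a ^ 2 - a * b + b ^ 2 = (a + b) ^ 2 - 3 * (a * b) := by ring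
    rw [this, hk]; ring

/-- **NSC-SEEDS-3 §3 (the Ext budget of a Gaussian–Weil object).**  (i) For `c = a + bζ₃ ∈ 𝒪_K ∖ 0` the budget `χ(G,G) = −∫w(c)² = 2N(c) =
2(a² − ab + b²)` is `≥ 2`.  (ii) For a SIMPLE object on an abelian sixfold (`ext⁰ = ext⁶ = 1`, `ext¹ = ext⁵`, `ext² = ext⁴`) with
`χ = 2 − 2e₁ + 2e₂ − e₃ = N > 0` and `e₂ ≥ 33` (LEMMA OB^{obj}): `e₃ ≡ N (mod 2)`, `2e₁ + N + e₃ = 2 + 2e₂ ≥ 68`, in particular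
`e₁ ≤ e₂ + 1 − N/2 − e₃/2`. [`omega` / `nlinarith`] -/
theorem nsc3_budget (a b : ℤ) (e₁ e₂ e₃ : ℕ) (N : ℤ) (hab : ¬ (a = 0 ∧ b = 0))
    (hchi : (2 : ℤ) - 2 * e₁ + 2 * e₂ - e₃ = N) (hN : 0 < N) (h33 : 33 ≤ e₂) :
    (2 ≤ 2 * (a ^ 2 - a * b + b ^ 2)) ∧
    ((e₃ : ℤ) % 2 = N % 2 ∧ 2 * (e₁ : ℤ) + N + e₃ = 2 + 2 * e₂ ∧ (68 : ℤ) ≤ 2 * (e₁ : ℤ) + N + e₃ ∧ 2 * (e₁ : ℤ) ≤ 2 * e₂ + 1) := by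
  refine ⟨?_, ?_, ?_, ?_, ?_⟩
  · -- 2N(c) ≥ 2 :  4N = (2a-b)² + 3b² ≥ 4 unless a = b = 0
    by_cases hb : b = 0
    · subst hb
      have ha : a ≠ 0 := fun h => hab ⟨h, rfl⟩
      have : 0 < a ^ 2 := by positivity
      nlinarith
    · have : 0 < b ^ 2 := by positivity
      nlinarith [sq_nonneg (2 * a - b)]
  · omega
  · omega
  · omega
  · omega

/-- **NSC-SEEDS-3 §4 (two-factor HN towers with Gaussian total: Lagrange).**  If `ch(F_i) = r_i + r_i t_i h + (r_i t_i²/2 − d_i)h² + …`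
(`i = 1,2`) sum to the Gaussian `r·e^{th}` in degrees `≤ 2` (`r = r₁ + r₂`, `rt = r₁t₁ + r₂t₂`), then the Bogomolov deficits satisfy
`d₁ + d₂ = r₁r₂(t₁ − t₂)²/(2r) > 0` for `t₁ ≠ t₂`: every factor configuration is strictly Bogomolov-unstable in total, consistent with
PROPOSITION NOSTAB, and nothing in degrees `≤ 2` obstructs the window. -/
theorem nsc3_lagrange_two (r₁ r₂ t₁ t₂ : ℚ) (hr : r₁ + r₂ ≠ 0) :
    r₁ * t₁ ^ 2 / 2 + r₂ * t₂ ^ 2 / 2 - (r₁ + r₂) * ((r₁ * t₁ + r₂ * t₂) / (r₁ + r₂)) ^ 2 / 2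
      = r₁ * r₂ * (t₁ - t₂) ^ 2 / (2 * (r₁ + r₂)) := by
  field_simp
  ring

/-- **NSC-SEEDS-3 §4 (the rank-2 window: parity).**  At a very general member (`NS = ℤh`) a rank-2 Gaussian–Weil sheaf has HN factors
`I_{Z₁}(n₁h)`, `I_{Z₂}(n₂h)` and the degree-2 Gaussian condition reads `(codim-2 degree of Z₁ ∪ Z₂)·4 = (n₁ − n₂)²`; hence `n₁ ≡ n₂ (mod 2)`. -/
theorem nsc3_rank_two_window_parity (n₁ n₂ z : ℤ) (h : (n₁ - n₂) ^ 2 = 4 * z) : 2 ∣ n₁ - n₂ := by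
  have h2 : (2 : ℤ) ∣ (n₁ - n₂) ^ 2 := ⟨2 * z, by linarith⟩
  exact Int.prime_two.dvd_of_dvd_pow h2

end NscSeedsThree

end Summit.HodgeConjecture.HodgeConjecture.WeilTypeLadder
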